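import Mathlib
import Summits.CriticalPhenomena.PercolationContinuityZ3.Theorems.PercNearOneGluingNoHeavyLowerTailHexMS
import Summits.CriticalPhenomena.PercolationContinuityZ3.Theorems.PercNearOneGluingNoHeavyLowerTailPairedSunflowerConjecture
import HarnessLib

/-!
# HEX-MS ⟹ Conjecture K♯ on 'pure' instances (the generated-donor reduction, hp-7 g64 Lemma A)

Support file for crux `stmt-CriticalPhenomena-4575`, hull-port seat `prim-hp-7` (generation 64); `--supports stmt-CriticalPhenomena-4575`.
No `sorry`.  Memo `run/shared/lean/prim/prim-hp-7/FROM-prim-hp-7-g64-HEXMS.md` §0(1),(5).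

For monotone labellings `g h : Finset α → Lab 3` call a charged set `q` (`OrientedAntipodalHall.IsCharged`) CREDITED if `q` or `qᶜ` is
good (`g = A` on the set, `h = B` on its complement); the uncredited charged sets are the DEBTOR sets.  The instance is PURE if every
debtor set `q` has `g q ≠ A` and `h qᶜ ≠ B`; then `g q = C_a`, `h qᶜ = C_b` (`a ≠ b`) and `g qᶜ = C_b`, `h q = C_a`, i.e. `q ↦ (a,b)`,
`qᶜ ↦ (b,a)` is an antipodal labelling of the debtor family by the six arcs of `K₃` = the vertices of a hexagon
(`arcIdx`, hexagon order `01,02,12,10,20,21`).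
**Lemma A (pure form, `antidonor_of_close`):** if debtor sets `q, s` carry close arcs (same tail or same head) then
`d = q \ s` is an ANTI-DONOR: `g dᶜ = A`, `h d = B`, and `d` is not charged.  Hence the HEX-MS generated family of the debtor family
consists of anti-donors, and **`kSharp_ineq_of_hexMS_of_pure`**: Conjecture HEX-MS implies the K♯ inequality
`#charged ≤ #{q : q good ∨ qᶜ good}` for every pure instance (all `α`, `g`, `h`).  The general instance needs the arc-labelled
version MS♯ of the memo.
-/

namespace Summit.CriticalPhenomena.PercolationContinuityZ3.Theorems

namespace GeneratedDonors

open Finset OrientedAntipodalHall AntipodalStrongHarris AntipodalStrongHarris.Lab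

/-- Hexagon index of the arc `(a,b)` of `K₃` (`a ≠ b`; the diagonal is junk): order `01 ↦ 0, 02 ↦ 1, 12 ↦ 2, 10 ↦ 3, 20 ↦ 4, 21 ↦ 5`,
so that reversal is the antipodal map `+3` and hexagon-adjacent arcs share a tail or a head. -/
def arcIdx : Fin 3 → Fin 3 → ZMod 6 := ![![0, 0, 1], ![3, 0, 2], ![4, 5, 0]]

/-- Reversing an arc is the antipodal map on the hexagon. -/
theorem arcIdx_swap (a b : Fin 3) (hab : a ≠ b) : arcIdx b a = arcIdx a b + 3 := by
  revert a b; decide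

/-- Two arcs are hexagon-close iff they share their tail or their head. -/
theorem close_arcIdx_iff (a b a' b' : Fin 3) (hab : a ≠ b) (hab' : a' ≠ b') :
    Close (arcIdx a b) (arcIdx a' b') ↔ (a = a' ∨ b = b') := by
  revert a b a' b'; decide

section Bridge

variable {α : Type} [Fintype α] [DecidableEq α]

/-- `q` is credited: `q` or its complement is good. -/
def Cred (g h : Finset α → Lab 3) (q : Finset α) : Prop :=
  (g q = top ∧ h (univ \ q) = bot) ∨ (g (univ \ q) = top ∧ h q = bot)

/-- Creditedness is decidable. -/
instance (g h : Finset α → Lab 3) (q : Finset α) : Decidable (Cred g h q) := by unfold Cred; infer_instance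

/-- In a pure instance every debtor set has petal labels arranged as an arc and its reverse:
`g q = C_a`, `h qᶜ = C_b`, `g qᶜ = C_b`, `h q = C_a` with `a ≠ b`. -/
theorem debtor_petals {g h : Finset α → Lab 3} {q : Finset α} (hc : IsCharged 3 g h q)
    (hp : g q ≠ top ∧ h (univ \ q) ≠ bot ∧ g (univ \ q) ≠ top ∧ h q ≠ bot) :
    ∃ a b : Fin 3, a ≠ b ∧ g q = petal a ∧ h (univ \ q) = petal b ∧ g (univ \ q) = petal b ∧ h q = petal a := by
  obtain ⟨a, b, hab, h1, h2, h3, h4⟩ := hc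
  obtain ⟨hp1, hp2, hp3, hp4⟩ := hp
  refine ⟨a, b, hab, ?_, ?_, ?_, ?_⟩
  · exact h1.resolve_right hp1
  · exact h4.resolve_left hp2
  · exact h3.resolve_right hp3
  · exact h2.resolve_left hp4

/-- **Lemma A, pure form.**  If debtor sets `q, s` carry arcs `(a,b)`, `(a',b')` with `a = a'` or `b = b'` (hexagon-close), then
`d = q \ s` is an anti-donor: `g dᶜ = A`, `h d = B`, and `g d = B` (so `d` is not charged). -/
theorem antidonor_of_close {g h : Finset α → Lab 3}
    (hg : ∀ ⦃X Y : Finset α⦄, X ⊆ Y → g X ≤ g Y) (hh : ∀ ⦃X Y : Finset α⦄, X ⊆ Y → h X ≤ h Y)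
    {q s : Finset α} {a b a' b' : Fin 3} (hab : a ≠ b) (hab' : a' ≠ b')
    (hq1 : g (univ \ q) = petal b) (hq2 : h q = petal a) (hq3 : g q = petal a)
    (hs1 : g s = petal a') (hs2 : h (univ \ s) = petal b') (hs3 : g (univ \ s) = petal b')
    (hcl : a = a' ∨ b = b') :
    g (univ \ (q \ s)) = top ∧ h (q \ s) = bot ∧ g (q \ s) = bot := by
  have hba' : b ≠ a' := by
    rcases hcl with rfl | rfl
    · exact fun h => hab h.symm
    · exact fun h => hab' h.symm
  have hab'2 : a ≠ b' := by
    rcases hcl with rfl | rfl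
    · exact hab'
    · exact hab
  have hsub1 : univ \ q ⊆ univ \ (q \ s) := sdiff_subset_sdiff (subset_refl _) sdiff_subset
  have hsub2 : s ⊆ univ \ (q \ s) := by
    intro x hx; rw [mem_sdiff]; exact ⟨mem_univ _, fun h' => (mem_sdiff.mp h').2 hx⟩
  have hsub3 : q \ s ⊆ q := sdiff_subset
  have hsub4 : q \ s ⊆ univ \ s := sdiff_subset_sdiff (subset_univ _) (subset_refl _)
  refine ⟨?_, ?_, ?_⟩
  · have e1 : petal b ≤ g (univ \ (q \ s)) := hq1 ▸ hg hsub1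
    have e2 : petal a' ≤ g (univ \ (q \ s)) := hs1 ▸ hg hsub2
    exact eq_top_of_petal_le hba' e1 e2
  · have e1 : h (q \ s) ≤ petal a := hq2 ▸ hh hsub3
    have e2 : h (q \ s) ≤ petal b' := hs2 ▸ hh hsub4
    exact eq_bot_of_le_petal hab'2 e1 e2
  · have e1 : g (q \ s) ≤ petal a := hq3 ▸ hg hsub3
    have e2 : g (q \ s) ≤ petal b' := hs3 ▸ hg hsub4
    exact eq_bot_of_le_petal hab'2 e1 e2

/-- **HEX-MS ⟹ the K♯ inequality for pure instances.**  If Conjecture HEX-MS holds, then for every pure pair of monotone labellings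
(`k = 3`) the charged sets are at most the sets `q` with `q` or `qᶜ` good — the inequality of `OrientedAntipodalHall.KSharp 3`.
Proof: the debtor family with its arc labelling is an antipodal ℤ₆-labelled family; by HEX-MS at least half of it is matched by
generated differences, which are anti-donors by `antidonor_of_close`; anti-donors and their complements (donors) are disjoint,
credited, uncharged and equinumerous. -/
theorem kSharp_ineq_of_hexMS_of_pure (hH : HexMS) (g h : Finset α → Lab 3)
    (hg : ∀ ⦃X Y : Finset α⦄, X ⊆ Y → g X ≤ g Y) (hh : ∀ ⦃X Y : Finset α⦄, X ⊆ Y → h X ≤ h Y)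
    (hpure : ∀ q : Finset α, IsCharged 3 g h q → ¬ Cred g h q →
      g q ≠ top ∧ h (univ \ q) ≠ bot ∧ g (univ \ q) ≠ top ∧ h q ≠ bot) :
    #{q ∈ (univ : Finset (Finset α)) | IsCharged 3 g h q} ≤
      #{q ∈ (univ : Finset (Finset α)) | (g q = top ∧ h (univ \ q) = bot) ∨ (g (univ \ q) = top ∧ h q = bot)} := by
  classical
  have hcc : ∀ q : Finset α, univ \ (univ \ q) = q := fun q => by
    rw [Finset.sdiff_sdiff_eq_self (subset_univ q)]
  -- families
  set Ch : Finset (Finset α) := {q ∈ (univ : Finset (Finset α)) | IsCharged 3 g h q} with hCh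
  set Cr : Finset (Finset α) := {q ∈ (univ : Finset (Finset α)) |
    (g q = top ∧ h (univ \ q) = bot) ∨ (g (univ \ q) = top ∧ h q = bot)} with hCr
  set Deb : Finset (Finset α) := {q ∈ (univ : Finset (Finset α)) | IsCharged 3 g h q ∧ ¬ Cred g h q} with hDeb
  set AD : Finset (Finset α) := {d ∈ (univ : Finset (Finset α)) |
    g (univ \ d) = top ∧ h d = bot ∧ g d = bot} with hAD
  have hmemCr : ∀ q, q ∈ Cr ↔ Cred g h q := fun q => by
    rw [hCr, mem_filter]; unfold Cred; simp only [mem_univ, true_and]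
  have hmemDeb : ∀ q, q ∈ Deb ↔ IsCharged 3 g h q ∧ ¬ Cred g h q := fun q => by
    rw [hDeb, mem_filter]; simp only [mem_univ, true_and]
  have hmemAD : ∀ d, d ∈ AD ↔ g (univ \ d) = top ∧ h d = bot ∧ g d = bot := fun d => by
    rw [hAD, mem_filter]; simp only [mem_univ, true_and]
  have hmemCh : ∀ q, q ∈ Ch ↔ IsCharged 3 g h q := fun q => by
    rw [hCh, mem_filter]; simp only [mem_univ, true_and]
  -- charged is complement-symmetric
  have hchsymm : ∀ q, IsCharged 3 g h q → IsCharged 3 g h (univ \ q) := by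
    rintro q ⟨a, b, hab, h1, h2, h3, h4⟩
    exact ⟨b, a, hab.symm, h3, h4, by rw [hcc]; exact h1, by rw [hcc]; exact h2⟩
  have hcrsymm : ∀ q, Cred g h q → Cred g h (univ \ q) := by
    rintro q (⟨h1, h2⟩ | ⟨h1, h2⟩)
    · exact Or.inr ⟨by rw [hcc]; exact h1, h2⟩
    · exact Or.inl ⟨h1, by rw [hcc]; exact h2⟩
  -- the arc labelling of debtor sets
  have harc : ∀ q ∈ Deb, ∃ a b : Fin 3, a ≠ b ∧ g q = petal a ∧ h (univ \ q) = petal b ∧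
      g (univ \ q) = petal b ∧ h q = petal a := fun q hq => by
    obtain ⟨hc, hnc⟩ := (hmemDeb q).1 hq
    exact debtor_petals hc (hpure q hc hnc)
  -- choose a, b
  let ta : Finset α → Fin 3 := fun q => if hq : q ∈ Deb then (harc q hq).choose else 0
  let tb : Finset α → Fin 3 := fun q => if hq : q ∈ Deb then (harc q hq).choose_spec.choose else 0
  have htab : ∀ q (hq : q ∈ Deb), ta q ≠ tb q ∧ g q = petal (ta q) ∧ h (univ \ q) = petal (tb q) ∧
      g (univ \ q) = petal (tb q) ∧ h q = petal (ta q) := by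
    intro q hq
    have := (harc q hq).choose_spec.choose_spec
    simp only [ta, tb, dif_pos hq]
    exact this
  let x : Finset α → ZMod 6 := fun q => arcIdx (ta q) (tb q)
  -- hypotheses of HEX-MS for (Deb, x)
  have hcompl : ∀ q ∈ Deb, univ \ q ∈ Deb := fun q hq => by
    obtain ⟨hc, hnc⟩ := (hmemDeb q).1 hq
    exact (hmemDeb _).2 ⟨hchsymm q hc, fun h' => hnc (by have := hcrsymm _ h'; rwa [hcc] at this)⟩
  have hanti : ∀ q ∈ Deb, x (univ \ q) = x q + 3 := by
    intro q hq
    have hq' := hcompl q hq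
    obtain ⟨hne, h1, h2, h3, h4⟩ := htab q hq
    obtain ⟨hne', h1', h2', h3', h4'⟩ := htab (univ \ q) hq'
    -- ta q̄ = tb q and tb q̄ = ta q
    have e1 : ta (univ \ q) = tb q := by
      have := h1'.symm.trans h3; exact petal.inj this
    have e2 : tb (univ \ q) = ta q := by
      rw [hcc] at h2'
      have := h2'.symm.trans h4; exact petal.inj this
    show arcIdx (ta (univ \ q)) (tb (univ \ q)) = arcIdx (ta q) (tb q) + 3
    rw [e1, e2]
    exact arcIdx_swap (ta q) (tb q) hne
  -- HEX-MS
  have hMS : #Deb ≤ 2 * #(gen Deb x) := hH α Deb x hcompl hanti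
  -- generated sets are anti-donors
  have hgenAD : gen Deb x ⊆ AD := by
    intro d hd
    obtain ⟨q, hq, s, hs, hcl, rfl⟩ := mem_gen.mp hd
    obtain ⟨hne, h1, h2, h3, h4⟩ := htab q hq
    obtain ⟨hne', h1', h2', h3', h4'⟩ := htab s hs
    have hcl' : ta q = ta s ∨ tb q = tb s := (close_arcIdx_iff _ _ _ _ hne hne').mp hcl
    exact (hmemAD _).2 (antidonor_of_close hg hh hne hne' h3 h4 h1 h1' h2' h3' hcl')
  -- anti-donors: uncharged, credited; their complements likewise; disjoint from the complements
  have hADcr : ∀ d ∈ AD, Cred g h d := fun d hd => by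
    obtain ⟨h1, h2, -⟩ := (hmemAD d).1 hd
    exact Or.inr ⟨h1, h2⟩
  have hADnch : ∀ d ∈ AD, ¬ IsCharged 3 g h d := by
    rintro d hd ⟨a, b, hab, h1, -, -, -⟩
    obtain ⟨-, -, h3⟩ := (hmemAD d).1 hd
    rcases h1 with h1 | h1 <;> rw [h3] at h1 <;> cases h1
  set coAD : Finset (Finset α) := AD.image fun d => univ \ d with hcoAD
  have hinj : ∀ q r : Finset α, univ \ q = univ \ r → q = r := fun q r hqr => by
    have := congrArg (fun s => (univ : Finset α) \ s) hqr
    simpa only [hcc] using this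
  have hcoADcard : #coAD = #AD := card_image_of_injOn fun q _ r _ hqr => hinj q r hqr
  have hdisj : Disjoint AD coAD := by
    rw [disjoint_left]
    intro d hd hd'
    obtain ⟨d', hd'mem, rfl⟩ := mem_image.mp hd'
    obtain ⟨-, -, h3⟩ := (hmemAD _).1 hd
    obtain ⟨h1', -, -⟩ := (hmemAD _).1 hd'mem
    rw [h1'] at h3; cases h3
  -- AD ∪ coAD ⊆ Cr \ Ch
  have hsub : AD ∪ coAD ⊆ Cr \ Ch := by
    intro d hd
    rw [mem_sdiff, hmemCr, hmemCh]
    rcases mem_union.mp hd with hd | hd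
    · exact ⟨hADcr d hd, hADnch d hd⟩
    · obtain ⟨d', hd', rfl⟩ := mem_image.mp hd
      refine ⟨hcrsymm _ (hADcr d' hd'), fun hc => hADnch d' hd' ?_⟩
      have := hchsymm _ hc; rwa [hcc] at this
  -- counting
  have h1 : #(AD ∪ coAD) = #AD + #AD := by rw [card_union_of_disjoint hdisj, hcoADcard]
  have h2 : #(AD ∪ coAD) ≤ #(Cr \ Ch) := card_le_card hsub
  have h3 : #(gen Deb x) ≤ #AD := card_le_card hgenAD
  have h4 : #(Cr \ Ch) + #(Cr ∩ Ch) = #Cr := card_sdiff_add_card_inter Cr Ch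
  have hDebeq : Deb = Ch \ Cr := by
    ext q; rw [hmemDeb, mem_sdiff, hmemCh, hmemCr]
  have h5 : #(Ch \ Cr) + #(Ch ∩ Cr) = #Ch := card_sdiff_add_card_inter Ch Cr
  have h6 : #(Ch ∩ Cr) = #(Cr ∩ Ch) := by rw [inter_comm]
  rw [← hDebeq] at h5
  omega

end Bridge

end GeneratedDonors

end Summit.CriticalPhenomena.PercolationContinuityZ3.Theorems
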